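import Summits.HodgeConjecture.CorCM.B01.Transposition.Item6PlacementJunctionAppendixCGood
import Literature.NumberTheory.Automorphic.Liu2021.Prop413MultLeOneOfAsPrinted
import HarnessLib

/-!
# Δ2 junction at the GOOD characters with the multiplicity pin `hmultD` REPLACED by [Liu2021, Prop. 4.13]'s STATEMENT shape
# (an equivariant decomposition of the tower) + Def. 4.11's adjectives + pairwise non-isomorphy of its summands

Cell pub-hodgecm2 (COR-CM), Δ2 BRIDGE («EXECUTION NOW», coordinator directive 2026-08-23T12:17Z); seat prover-pub-hodgecm-own-htheta-g9-0
(own-htheta gen 9, X3 co-owner, author of the Q2-SCHUR files).  Theorems only; nothing landed is edited or restated; HOLE-FREE (imports the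
✔ `…AppendixCGood` junction and the ✔ Literature file `Liu2021/Prop413MultLeOneOfAsPrinted`, not the `Model.Universe` cone).

The records-form junction of record `thm418Combined_of_thm418AsPrintedC_summands_records_of_good` (pin-3, ✔ p354237) concludes the combined
reading r8 `T.Thm418Combined res cmCl` — the BODY of `LiuDictionary.Thm418C` — from [Liu2021, Thm. 4.18] AS PRINTED at the good characters
(`hLiu`) and the named pins; among them the MULTIPLICITY pin
`hmultD : Module.rank ℂ (Hom_{ℂ[𝔾(𝔸_F^∞)]}(ω_i, Tower)) ≤ 1`, whose only supplier so far was the PROOF sentence of Prop. 4.13 (l. 2145,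
`Prop413Data.MultOneAsPrinted`).  This file re-cuts that junction with `hmultD` DERIVED in the kernel (Schur's lemma for irreducible admissible
representations, ✔ `Literature/RepresentationTheory/AdmissibleDirectSumMultiplicityOne.lean`, through the Liu-adjective bridges of ✔
`Liu2021/Prop413MultLeOneOfAsPrinted.lean`) from inputs in the currency of the STATEMENTS as printed:

* `Φ413 ∕ hΦ413` — a `ℂ`-linear equivalence of the tower `T.H` with a direct sum `⨁ t, W413 t` intertwining the tower action
  `Representation.ofModule' T.H` with representations `σ413 t` — VERBATIM the shape of `Liu2021.Prop413AsPrinted` («there is an isomorphism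
  `H¹_{B,τ'}(A_∞, ℂ) ≃ ⊕_{(μ,ε,χ)} ω(μ,ε,χ)` of `ℂ[𝔾(𝔸_F^∞)]`-modules», ll. 2113–2119) read at the consumer's tower (the `∃ Φ` content of
  `Prop413AsPrinted P` for a `P : Prop413Data` with `P.HB τ' :=` the tower — the packaging into a `Prop413Data` is the bridge seats' S6a);
* `h411W` — Def. 4.11's printed adjectives of the summands (irreducible-or-zero, smooth, admissible: `IsIrreducibleOrZero ∧ IsSmoothRep ∧ IsAdmissibleRep`,
  the conjunct shape of `Liu2021.Def411AsPrinted`);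
* `hsepW` — the summands are pairwise non-isomorphic, in the shape of `Thm418Data.AreIsomorphic` (same `μ`: Thm. 4.18 (2) as printed;
  across `μ`: App. D Lem. D.1 (3) per place + local isotypy, `Prop413Data.admTriple_eq_of_areIsomorphic_of_local`);
* `hirrD` — Def. 4.11's «irreducible» (zero allowed) for the summands of the per-character App-C datum `toThm418Data C (R μ hμ hg)`
  (`Thm418Data.isIrreducibleOrZero_rhoAt` of `Def411AsPrinted`, or item6-p3's `rhoAt_restOfCharD_isIrreducible_of_lemD1AsPrinted` from Lem. D.1 (1));
the compact open subgroup Schur needs is any level `Γ.K` (`Nonempty (HodgeCM.Level V)`, ✔ `Model/ToyG2/LevelExists`).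

* `thm418Combined_of_thm418AsPrintedC_summands_records_of_good_of_decomposition` — the re-cut junction.
HC_CM is NOT proved; no pin is discharged here beyond `hmultD`; nothing about Liu's objects is constructed; «Δ2 BRIDGE CLOSED» is NOT claimed.
-/

set_option autoImplicit false

noncomputable section

open scoped DirectSum TensorProduct

namespace HodgeCM.Literature.Theta

namespace LiuAlbaneseModuleDatum

open Summit.HodgeConjecture.CorCM
open Literature.AlgebraicGeometry.ShimuraVarieties.UnitaryCanonicalModel
open Literature.NumberTheory.Automorphic.Liu2021 Literature.NumberTheory.Automorphic.Liu2021.AppendixC NumberField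
open Literature.RepresentationTheory
open MulAction

universe w

/-- **Δ2 IN ONE THEOREM, RECORDS FORM, GOOD CHARACTERS ONLY, WITH THE MULTIPLICITY PIN DERIVED FROM PROP. 4.13's STATEMENT SHAPE.**
As `thm418Combined_of_thm418AsPrintedC_summands_records_of_good` (✔ p354237), binder for binder, EXCEPT that
`hmultD : ∀ μ hμ hg i, Module.rank ℂ (Representation.IntertwiningMap ((toThm418Data C (R μ hμ hg)).rhoAt i) (Representation.ofModule' T.H)) ≤ 1`
is no longer asked: it is DERIVED (`Prop413Data`-free form of `Prop413Data.rank_intertwiningMap_le_one_of_asPrinted`, i.e.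
`AdmissibleDirectSum.rank_intertwiningMap_le_one_of_equivariant_directSum`) from an equivariant decomposition `Φ413 ∕ hΦ413` of the tower into
summands `σ413 t` that are irreducible-or-zero ∕ smooth ∕ admissible (`h411W`, Def. 4.11's adjectives) and pairwise non-isomorphic (`hsepW`,
`AreIsomorphic` shape), the source summands being irreducible-or-zero (`hirrD`) and non-zero (`hnvD`); the compact open subgroup is a level.
[cite: Liu2021, Thm. 4.18 (FJcycle.tex l. 2232–2245) with proof l. 2247–2268 and map (4.3) l. 2250–2253, Thm. 4.18 (1) (l. 2239), Thm. 4.18 (2) (l. 2241), Lem. 2.4 (1) (l. 1210–1213), Prop. 4.13 (ll. 2113–2119) with proof l. 2145, Def. 4.5 (2) (l. 1944–1952), Def. 4.11 (ll. 2083–2097), App. D Lem. D.1 (1), (3) (ll. 5226–5233), §4.2 l. 2053–2081, App. C l. 4618–4624, Prop. C.5 (l. 4624–4637)]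
[cite: Bump1997, Proposition 4.2.4] [cite: Deligne1979ShimuraVarieties, 2.2.5 and Cor. 2.7.21] -/
theorem thm418Combined_of_thm418AsPrintedC_summands_records_of_good_of_decomposition
    {L : HodgeCM.CMField} {ι₁ : L →+* ℂ} (V : HodgeCM.HermSpace3 L ι₁)
    (h : exists_recordSystem) (Φ : Literature.AlgebraicGeometry.Motives.CMType L)
    {isotropicAt : ℕ → Prop}
    (C : Sec42Data (Model.honestP5Of h ⟨L.K⟩ ι₁ ⟨V.Hm, V.isHermitian, V.signature_ι₁, V.posDef_of_ne⟩ Φ) isotropicAt)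
    (T : LiuAlbaneseModuleDatum ↥V.adelicFin (HodgeCM.Level.K : HodgeCM.Level V → Subgroup ↥V.adelicFin))
    {W : HodgeCM.Level V → Type w} [∀ K, AddCommGroup (W K)] [∀ K, Module ℂ (W K)]
    (res : ∀ K : HodgeCM.Level V, T.H →ₗ[ℂ] W K) (cmCl : ∀ K : HodgeCM.Level V, T.Char → Set (W K))
    (Good : T.Char → Prop) (hbad : ∀ μ : T.Char, T.PhiMu μ → ¬ Good μ → T.block μ = ⊥)
    (R : ∀ μ : T.Char, T.PhiMu μ → Good μ → Thm418Rest C)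
    (hLiu : ∀ (μ : T.Char) (hμ : T.PhiMu μ) (hg : Good μ), Thm418AsPrintedC C (R μ hμ hg))
    (σ : ∀ (μ : T.Char) (hμ : T.PhiMu μ) (hg : Good μ), T.Adm μ → (toThm418Data C (R μ hμ hg)).AdmIndex)
    (hσ : ∀ (μ : T.Char) (hμ : T.PhiMu μ) (hg : Good μ), Function.Injective (σ μ hμ hg))
    (e : ∀ (μ : T.Char) (hμ : T.PhiMu μ) (hg : Good μ) (a : T.Adm μ),
      T.Ω μ a ≃ₗ[ℂ] (toThm418Data C (R μ hμ hg)).omegaAt (σ μ hμ hg a))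
    (he : ∀ (μ : T.Char) (hμ : T.PhiMu μ) (hg : Good μ) (a : T.Adm μ) (g : ↥V.adelicFin) (m : T.Ω μ a),
      e μ hμ hg a (MonoidAlgebra.of ℂ ↥V.adelicFin g • m) = (toThm418Data C (R μ hμ hg)).rhoAt (σ μ hμ hg a) g (e μ hμ hg a m))
    (M : ∀ (μ : T.Char) (hμ : T.PhiMu μ) (hg : Good μ), (toThm418Data C (R μ hμ hg)).Map43RationalData)
    (jH : ∀ (μ : T.Char) (hμ : T.PhiMu μ) (hg : Good μ), (M μ hμ hg).HB →ₗ[ℂ] T.H)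
    (hjHinj : ∀ (μ : T.Char) (hμ : T.PhiMu μ) (hg : Good μ), Function.Injective (jH μ hμ hg))
    (hjH : ∀ (μ : T.Char) (hμ : T.PhiMu μ) (hg : Good μ) (g : ↥V.adelicFin) (x : (M μ hμ hg).HB),
      jH μ hμ hg ((M μ hμ hg).ρB g x) = MonoidAlgebra.of ℂ ↥V.adelicFin g • jH μ hμ hg x)
    (hcm : ∀ (μ : T.Char) (hμ : T.PhiMu μ) (hg : Good μ) (K : HodgeCM.Level V)
      (φ : (toThm418Data C (R μ hμ hg)).HomK K.K (M μ hμ hg).Dμ),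
      res K (jH μ hμ hg ((M μ hμ hg).ι
        (((M μ hμ hg).P ((toThm418Data C (R μ hμ hg)).res K.K (M μ hμ hg).Dμ φ)).baseChange ℂ (M μ hμ hg).α))) ∈ cmCl K μ)
    (hnvD : ∀ (μ : T.Char) (hμ : T.PhiMu μ) (hg : Good μ) (i : (toThm418Data C (R μ hμ hg)).AdmIndex),
      Nontrivial ((toThm418Data C (R μ hμ hg)).omegaAt i))
    (hirrD : ∀ (μ : T.Char) (hμ : T.PhiMu μ) (hg : Good μ) (i : (toThm418Data C (R μ hμ hg)).AdmIndex),
      IsIrreducibleOrZero ((toThm418Data C (R μ hμ hg)).rhoAt i))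
    -- [Liu2021, Prop. 4.13]'s STATEMENT shape at the tower: an equivariant decomposition into summands `σ413 t`
    {ι413 : Type} {W413 : ι413 → Type} [∀ t, AddCommGroup (W413 t)] [∀ t, Module ℂ (W413 t)]
    (σ413 : ∀ t : ι413, Representation ℂ ↥V.adelicFin (W413 t))
    (Φ413 : T.H ≃ₗ[ℂ] ⨁ t, W413 t)
    (hΦ413 : ∀ (g : ↥V.adelicFin) (x : T.H) (t : ι413),
      Φ413 (Representation.ofModule' (k := ℂ) (G := ↥V.adelicFin) T.H g x) t = σ413 t g (Φ413 x t))
    -- [Liu2021, Def. 4.11]'s adjectives of the summands, and their pairwise non-isomorphy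
    (h411W : ∀ t : ι413, IsIrreducibleOrZero (σ413 t) ∧ IsSmoothRep (σ413 t) ∧ IsAdmissibleRep (σ413 t))
    (hsepW : ∀ s t : ι413, Nontrivial (W413 s) →
      (∃ f : W413 s ≃ₗ[ℂ] W413 t, ∀ (g : ↥V.adelicFin) (v : W413 s), f (σ413 s g v) = σ413 t g (f v)) → s = t) :
    T.Thm418Combined res cmCl := by
  refine thm418Combined_of_thm418AsPrintedC_summands_records_of_good V h Φ C T res cmCl Good hbad R hLiu σ hσ e he M jH
    hjHinj hjH hcm hnvD fun μ hμ hg i => ?_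
  -- the multiplicity pin, DERIVED: Schur for irreducible admissible representations in Hom-space form; the source summand is
  -- read as a representation of `↥V.adelicFin` (= `(toThm418Data C (R μ hμ hg)).G` definitionally) so that the topological-group
  -- instances of the levels apply
  obtain ⟨Γ₀⟩ := (inferInstance : Nonempty (HodgeCM.Level V))
  let ρ : Representation ℂ ↥V.adelicFin ((toThm418Data C (R μ hμ hg)).omegaAt i) := (toThm418Data C (R μ hμ hg)).rhoAt i
  haveI := hnvD μ hμ hg i
  haveI : ρ.IsIrreducible := isIrreducible_of_isIrreducibleOrZero (hirrD μ hμ hg i) inferInstance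
  exact AdmissibleDirectSum.rank_intertwiningMap_le_one_of_equivariant_directSum (ρ := ρ) (σ := σ413) Φ413 hΦ413
    (fun t ht => isIrreducible_of_isIrreducibleOrZero (h411W t).1 ht)
    (fun t => isAdmissible_of_isSmoothRep_of_isAdmissibleRep (h411W t).2.1 (h411W t).2.2)
    (fun s t hs ⟨f⟩ => hsepW s t hs ⟨f.toLinearEquiv, fun g v => by
      rw [Representation.Equiv.toLinearEquiv_apply, Representation.Equiv.toLinearEquiv_apply]
      exact f.toIntertwiningMap.isIntertwining _ _ g v⟩)
    ⟨Γ₀.K, Γ₀.isOpen_K, Γ₀.isCompact_K⟩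

end LiuAlbaneseModuleDatum

end HodgeCM.Literature.Theta

end
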